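import Summits.ResolutionOfSingularities.ResolutionOfSingularities.Theorems.WeightedInvariantIota3RatioMaxNonSolvable
import HarnessLib

/-!
# THE CRITICAL TRIPLE `(r₂; j·r₁, j·r₂)` OF A SECOND MEMBER OF LEVEL `qj < r₂`: level of the second member, comparison of the
# filtrations, purity of level `r₁ν` (door `HypersurfaceCentreConstruction`, stmt-ResolutionOfSingularities-19897; bricks 2–4 of the
# residue hres₃ of `keyRungGrHomLE_three_of_residue3`)

Helper for `stub_keyRungGrHomLE_three` (def-free, `--supports 19897`).  Setting of the residue hres₃ (second-member dominance at
`q < r₂ < r₁`): a two-flag `(g₁, g₂)`, its filtration `F = F_{(g₁,g₂; q,r₁,r₂)}`, and a second member `g₂'` of another flag with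
`g₂' ∉ F(r₂)`.  In any local ring:

* `exists_level_of_not_mem` — **the level of `g₂'`**: `g₂' ∈ F(qj) ∖ F(qj+1)` for a unique `1 ≤ j` with `qj < r₂` (the level is a
  multiple of `q` because below `r₂` only the transversal pieces `𝔪^⌈n/q⌉` of `F(n)` are new);
* `flagContactFiltration_le_critical` — `F(n) ≤ F₃(j·n)` for the CRITICAL TRIPLE `F₃ = F_{(g₁,g₂; r₂, j r₁, j r₂)}` (weights
  `(1, j, jρ)` on `(x, g₂, g₁)` in place of `(1, w₂, w₁)`, same ratio `ρ = r₁/r₂`; needs `qj ≤ r₂`): both flags still reach the critical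
  triple, and `g₂' ∈ 𝔪^j + F(r₂) ≤ F₃(j r₂)` — so (E1) applies THERE and the two flags have comparable critical filtrations;
* `critical_succ_le` — `F₃(j r₂ + 1) ≤ F(qj + 1)`: the initial form of `g₂'` in critical degree `j r₂` has a non-zero `X^j` term;
* `flagContactFiltration_le_pure_sup_critical` — **PURITY**: `F(r₁ν) ≤ P ⊔ F₃(j r₁ ν + 1)` with `P = Σ_{r₁c + r₂b = r₁ν} (g₁^c g₂^b)`
  (needs `qj < r₂`): in the critical graded ring `κ[X, V, Y]` the initial form of every element of `F(r₁ν)` — of `f` for BOTH flags —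
  is a polynomial in the two flag variables alone.

Together with LEMMA B (…Iota3RatioMaxNonSolvable) these reduce hres₃ to one statement of pure algebra in `κ[X, V, Y]` (LEMMA C of the
memo RESIDUE-PLAN.md: `Φ ∈ κ[V, Y] ∩ κ[ēX^j + β̄V, λ̄Y + θ(X, V)]`, `Φ ∋ Y^ν` ⇒ `Φ = c(Y − aV^ρ)^ν`) and the `inForm` bookkeeping.
[OURS · L1 W4.3 · (o70-b)/(Δ12); AI work, weaker than expert review; nothing here is a statement of the manuscript under review.]
-/

noncomputable section

open IsLocalRing Literature.AlgebraicGeometry.Resolution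
open Summit.ResolutionOfSingularities.ResolutionOfSingularities.Theorems

set_option linter.dupNamespace false -- mandated namespace of this single-conjunct summit

namespace Summit.ResolutionOfSingularities.ResolutionOfSingularities.Cruxes.HypersurfaceCentreConstruction.LocalEngine

namespace Iota3

universe u

variable {S : Type u} [CommRing S] [IsLocalRing S]

/-! ## §1 The level of a second member below `r₂` is a multiple of `q` -/

/-- Below `r₂` the filtration only moves at multiples of `q`: `F(n) ≤ F(n + 1)` whenever `n < r₂`, `q ∤ n` (`r₂ ≤ r₁`). [folklore] -/
theorem flagContactFiltration_le_succ_of_not_dvd {g₁ g₂ : S} {q r₁ r₂ n : ℕ} (hq : 0 < q) (hr : r₂ ≤ r₁)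
    (hn : n < r₂) (hdvd : ¬ q ∣ n) :
    flagContactFiltration g₁ g₂ q r₁ r₂ n ≤ flagContactFiltration g₁ g₂ q r₁ r₂ (n + 1) := by
  rw [flagContactFiltration_def g₁ g₂ q r₁ r₂ n]
  refine iSup_le fun α => iSup_le fun β => ?_
  rw [Ideal.mul_le]
  intro i hi m hm
  obtain ⟨d, rfl⟩ := Ideal.mem_span_singleton'.mp hi
  have heq : d * (g₁ ^ α * g₂ ^ β) * m = g₁ ^ α * g₂ ^ β * (d * m) := by ring
  rw [heq]
  refine mul_mem_flagContactFiltration_of_weight hq (Ideal.mul_mem_left _ d hm) ?_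
  -- weights: a non-trivial flag monomial already has weight `≥ r₂ > n`; the transversal piece has `q⌈n/q⌉ ≥ n + 1`
  have hk := le_mul_pieceExponent hq n r₁ r₂ α β
  rcases Nat.eq_zero_or_pos (α + β) with h0 | hpos
  · have hα : α = 0 := by omega
    have hβ : β = 0 := by omega
    subst hα; subst hβ
    simp only [mul_zero, Nat.sub_zero, zero_add, add_zero] at hk ⊢
    -- `q · ⌈n/q⌉ ≠ n` since `q ∤ n`
    have hne : q * ((n + q - 1) / q) ≠ n := fun h => hdvd ⟨_, h.symm⟩
    omega
  · have : r₂ ≤ r₁ * α + r₂ * β := by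
      rcases Nat.eq_zero_or_pos α with hα | hα
      · have hβ : 1 ≤ β := by omega
        nlinarith
      · nlinarith
    omega

/-- **THE LEVEL OF A SECOND MEMBER.**  If `g₂' ∈ 𝔪` and `g₂' ∉ F(r₂)` (`0 < q ≤ r₂ ≤ r₁`), then for a (unique) `j ≥ 1` with `qj < r₂`:
`g₂' ∈ F(qj) ∖ F(qj + 1)`. [OURS · L1 W4.3 · (o70-b)] -/
theorem exists_level_of_not_mem {g₁ g₂ g₂' : S} {q r₁ r₂ : ℕ} (hq : 0 < q) (hq₂ : q ≤ r₂) (hr : r₂ ≤ r₁)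
    (hg₂' : g₂' ∈ maximalIdeal S) (hnot : g₂' ∉ flagContactFiltration g₁ g₂ q r₁ r₂ r₂) :
    ∃ j : ℕ, 1 ≤ j ∧ q * j < r₂ ∧ g₂' ∈ flagContactFiltration g₁ g₂ q r₁ r₂ (q * j) ∧
      g₂' ∉ flagContactFiltration g₁ g₂ q r₁ r₂ (q * j + 1) := by
  classical
  set P : ℕ → Prop := fun n => g₂' ∈ flagContactFiltration g₁ g₂ q r₁ r₂ n with hP
  set s := Nat.findGreatest P r₂ with hs
  have hPq : P q := maximalIdeal_le_flagContactFiltration g₁ g₂ r₁ r₂ hq hg₂'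
  have hPs : g₂' ∈ flagContactFiltration g₁ g₂ q r₁ r₂ s := Nat.findGreatest_spec (P := P) hq₂ hPq
  have hqs : q ≤ s := Nat.le_findGreatest hq₂ hPq
  have hsr : s ≤ r₂ := Nat.findGreatest_le r₂
  have hsne : s ≠ r₂ := fun h => hnot (by rw [h] at hPs; exact hPs)
  have hslt : s < r₂ := lt_of_le_of_ne hsr hsne
  have hnot' : g₂' ∉ flagContactFiltration g₁ g₂ q r₁ r₂ (s + 1) :=
    Nat.findGreatest_is_greatest (P := P) (Nat.lt_succ_self s) (by omega)
  have hdvd : q ∣ s := by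
    by_contra h
    exact hnot' (flagContactFiltration_le_succ_of_not_dvd hq hr hslt h hPs)
  obtain ⟨j, hj⟩ := hdvd
  refine ⟨j, ?_, by rw [← hj]; exact hslt, by rw [← hj]; exact hPs, by rw [← hj]; exact hnot'⟩
  rcases Nat.eq_zero_or_pos j with h0 | h0
  · rw [h0, mul_zero] at hj; omega
  · exact h0

/-! ## §2 The critical triple `(r₂; j r₁, j r₂)` -/

/-- **`F(n) ≤ F₃(j n)`** for the critical triple `F₃ = F_{(g₁,g₂; r₂, j r₁, j r₂)}` when `qj ≤ r₂` (`0 < q`, `1 ≤ j`): lowering the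
second weight from `r₂/q` to `j` (and the first proportionally) only enlarges the levels, reindexed by `j`. [OURS · L1 W4.3 · (o70-b)] -/
theorem flagContactFiltration_le_critical {g₁ g₂ : S} {q r₁ r₂ j : ℕ} (hq : 0 < q) (hj : 1 ≤ j) (hqj : q * j ≤ r₂) (n : ℕ) :
    flagContactFiltration g₁ g₂ q r₁ r₂ n ≤ flagContactFiltration g₁ g₂ r₂ (j * r₁) (j * r₂) (j * n) := by
  refine flagContactFiltration_le_of_weights hq (lt_of_lt_of_le (Nat.mul_pos hq hj) hqj) fun α β k hk => ?_
  have h1 : j * n ≤ j * (r₁ * α + r₂ * β + q * k) := Nat.mul_le_mul_left j hk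
  have h2 : q * j * k ≤ r₂ * k := Nat.mul_le_mul_right k hqj
  nlinarith [h1, h2]

/-- Both flags reach the critical triple: `f ∈ F(r₁ν) ⇒ f ∈ F₃((j r₁) ν)`. [folklore] -/
theorem mem_critical_of_mem {g₁ g₂ f : S} {q r₁ r₂ j ν : ℕ} (hq : 0 < q) (hj : 1 ≤ j) (hqj : q * j ≤ r₂)
    (hf : f ∈ flagContactFiltration g₁ g₂ q r₁ r₂ (r₁ * ν)) :
    f ∈ flagContactFiltration g₁ g₂ r₂ (j * r₁) (j * r₂) (j * r₁ * ν) := by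
  have h := flagContactFiltration_le_critical hq hj hqj (r₁ * ν) hf
  rwa [← mul_assoc] at h

/-- The second member reaches its critical level: `g₂' ∈ F(qj) ⇒ g₂' ∈ F₃(j r₂)`... more precisely every element of `F(qj)` lies in
`F₃(j·qj) ≥`; we record the form used: `𝔪^j ≤ F₃(j r₂)` and `F(r₂) ≤ F₃(j r₂)`. [folklore] -/
theorem pow_le_critical (g₁ g₂ : S) {q r₁ r₂ j : ℕ} (hq : 0 < q) (hj : 1 ≤ j) (hqj : q * j ≤ r₂) :
    maximalIdeal S ^ j ≤ flagContactFiltration g₁ g₂ r₂ (j * r₁) (j * r₂) (j * r₂) := by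
  have hQ : 0 < r₂ := lt_of_lt_of_le (Nat.mul_pos hq hj) hqj
  refine (Ideal.pow_right_mono (maximalIdeal_le_flagContactFiltration g₁ g₂ (j * r₁) (j * r₂) hQ) j).trans ?_
  have h := pow_le_flagContactFiltration_mul g₁ g₂ (q := r₂) (j * r₁) (j * r₂) hQ r₂ j
  rwa [mul_comm r₂ j] at h

/-- `F(qj) ≤ F₃(j r₂)`?  No — but the level-`qj` MEMBER does: `g₂' ∈ F(qj)` with `qj < r₂` lies in `𝔪^j + F(r₂)`, and both summands
lie in `F₃(j r₂)`.  We prove the clean statement `F(qj) ≤ 𝔪^j ⊔ F(r₂)` (`r₂ ≤ r₁`). [folklore] -/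
theorem flagContactFiltration_level_le_pow_sup {g₁ g₂ : S} {q r₁ r₂ j : ℕ} (hq : 0 < q) (hr : r₂ ≤ r₁) :
    flagContactFiltration g₁ g₂ q r₁ r₂ (q * j) ≤ maximalIdeal S ^ j ⊔ flagContactFiltration g₁ g₂ q r₁ r₂ r₂ := by
  rw [flagContactFiltration_def g₁ g₂ q r₁ r₂ (q * j)]
  refine iSup_le fun α => iSup_le fun β => ?_
  rcases Nat.eq_zero_or_pos (α + β) with h0 | hpos
  · have hα : α = 0 := by omega
    have hβ : β = 0 := by omega
    subst hα; subst hβ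
    refine le_sup_of_le_left ?_
    have he : (q * j - r₁ * 0 - r₂ * 0 + q - 1) / q = j := by
      rw [mul_zero, mul_zero, Nat.sub_zero, Nat.sub_zero]
      have : q * j + q - 1 = q - 1 + q * j := by omega
      rw [this, Nat.add_mul_div_left _ _ hq, Nat.div_eq_of_lt (by omega), zero_add]
    rw [he, pow_zero, pow_zero, mul_one, Ideal.span_singleton_one, Ideal.top_mul]
  · refine le_sup_of_le_right ?_
    rw [Ideal.mul_le]
    intro i hi m hm
    obtain ⟨d, rfl⟩ := Ideal.mem_span_singleton'.mp hi
    have heq : d * (g₁ ^ α * g₂ ^ β) * m = g₁ ^ α * g₂ ^ β * (d * m) := by ring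
    rw [heq]
    refine mul_mem_flagContactFiltration_of_weight hq (Ideal.mul_mem_left _ d hm) ?_
    rcases Nat.eq_zero_or_pos α with hα | hα
    · have hβ : 1 ≤ β := by omega
      have := Nat.mul_le_mul_left r₂ hβ
      rw [mul_one] at this
      omega
    · have h1 : 1 ≤ α := hα
      have := Nat.mul_le_mul_left r₁ h1
      rw [mul_one] at this
      omega

/-- **The second member reaches the critical level `j r₂`**: `g₂' ∈ F(qj)`, `qj ≤ r₂ ≤ r₁` ⇒ `g₂' ∈ F₃(j r₂)`. [OURS · L1 W4.3 · (o70-b)] -/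
theorem mem_critical_of_mem_level {g₁ g₂ g₂' : S} {q r₁ r₂ j : ℕ} (hq : 0 < q) (hj : 1 ≤ j) (hqj : q * j ≤ r₂) (hr : r₂ ≤ r₁)
    (h : g₂' ∈ flagContactFiltration g₁ g₂ q r₁ r₂ (q * j)) :
    g₂' ∈ flagContactFiltration g₁ g₂ r₂ (j * r₁) (j * r₂) (j * r₂) := by
  obtain ⟨m, hm, y, hy, rfl⟩ := Submodule.mem_sup.mp (flagContactFiltration_level_le_pow_sup hq hr h)
  refine Ideal.add_mem _ (pow_le_critical g₁ g₂ hq hj hqj hm) ?_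
  have h' := flagContactFiltration_le_critical hq hj hqj r₂ hy
  exact h'

/-- **`F₃(j r₂ + 1) ≤ F(qj + 1)`** (`qj + 1 ≤ r₂ ≤ r₁`, `0 < q`; any `j`): an element one critical step above the level of `g₂'` is one
`(q;r₁,r₂)`-step above it — so the critical initial form of `g₂'` in degree `j r₂` has a non-zero `X^j` term. [OURS · L1 W4.3 · (o70-b)] -/
theorem critical_succ_le {g₁ g₂ : S} {q r₁ r₂ j : ℕ} (hq : 0 < q) (hqj : q * j + 1 ≤ r₂) (hr : r₂ ≤ r₁) :
    flagContactFiltration g₁ g₂ r₂ (j * r₁) (j * r₂) (j * r₂ + 1) ≤ flagContactFiltration g₁ g₂ q r₁ r₂ (q * j + 1) := by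
  have hQ : 0 < r₂ := by omega
  refine flagContactFiltration_le_of_weights hQ hq fun α β k hk => ?_
  rcases Nat.eq_zero_or_pos (α + β) with h0 | hpos
  · have hα : α = 0 := by omega
    have hβ : β = 0 := by omega
    subst hα; subst hβ
    simp only [mul_zero, zero_add] at hk ⊢
    -- `j r₂ + 1 ≤ r₂ k` forces `k ≥ j + 1`
    have hk' : j + 1 ≤ k := by
      by_contra hlt
      have : k ≤ j := by omega
      have := Nat.mul_le_mul_left r₂ this
      rw [mul_comm r₂ j] at this
      omega
    nlinarith
  · rcases Nat.eq_zero_or_pos α with hα | hα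
    · have hβ : 1 ≤ β := by omega
      nlinarith
    · nlinarith

/-! ## §3 Purity of level `r₁ν` in the critical graded ring -/

/-- Weight bookkeeping for purity: for a piece `(α, β)` of `F(r₁ν)` with `𝔪`-exponent `e` (so `r₁ν ≤ r₁α + r₂β + qe`, and `e = 0`
unless `r₁α + r₂β < r₁ν`) and `r₁α + r₂β ≠ r₁ν`, `qj + 1 ≤ r₂`, `1 ≤ j`: `j r₁ ν + 1 ≤ j r₁ α + j r₂ β + r₂ e`. [folklore] -/
theorem purity_weight {q r₁ r₂ j ν α β e : ℕ} (hj : 1 ≤ j) (hqj : q * j + 1 ≤ r₂)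
    (hk : r₁ * ν ≤ r₁ * α + r₂ * β + q * e) (he : r₁ * α + r₂ * β < r₁ * ν ∨ e = 0) (hne : r₁ * α + r₂ * β ≠ r₁ * ν) :
    j * r₁ * ν + 1 ≤ j * r₁ * α + j * r₂ * β + r₂ * e := by
  rcases he with hlt | h0
  · -- `e ≥ 1`
    have he1 : 1 ≤ e := by
      by_contra h
      have : e = 0 := by omega
      rw [this, mul_zero, add_zero] at hk
      omega
    have h1 : j * (r₁ * ν) ≤ j * (r₁ * α + r₂ * β + q * e) := Nat.mul_le_mul_left j hk
    have h2 : (q * j + 1) * e ≤ r₂ * e := Nat.mul_le_mul_right e hqj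
    nlinarith [h1, h2, he1]
  · subst h0
    rw [mul_zero, add_zero] at hk
    have hgt : r₁ * ν + 1 ≤ r₁ * α + r₂ * β := by omega
    have h1 : j * (r₁ * ν + 1) ≤ j * (r₁ * α + r₂ * β) := Nat.mul_le_mul_left j hgt
    nlinarith [h1, hj]

/-- **PURITY AT THE CRITICAL TRIPLE.**  For `0 < q`, `1 ≤ j`, `qj < r₂`:
`F(r₁ν) ≤ (⨆_{r₁c + r₂b = r₁ν} (g₁^c g₂^b)) ⊔ F₃(j r₁ ν + 1)` — modulo one critical step, level `r₁ν` is spanned by the PURE flag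
monomials of exact weight `r₁ν`; in the critical graded ring `κ[X, V, Y]` the degree-`j r₁ ν` initial form of any element of `F(r₁ν)`
lies in `κ[V, Y]`. [OURS · L1 W4.3 · (o70-b)] -/
theorem flagContactFiltration_le_pure_sup_critical (g₁ g₂ : S) {q r₁ r₂ j : ℕ} (hq : 0 < q) (hj : 1 ≤ j) (hqj : q * j < r₂)
    (ν : ℕ) :
    flagContactFiltration g₁ g₂ q r₁ r₂ (r₁ * ν) ≤
      (⨆ α : ℕ, ⨆ β : ℕ, ⨆ (_ : r₁ * α + r₂ * β = r₁ * ν), Ideal.span {g₁ ^ α * g₂ ^ β}) ⊔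
        flagContactFiltration g₁ g₂ r₂ (j * r₁) (j * r₂) (j * r₁ * ν + 1) := by
  have hQ : 0 < r₂ := by omega
  rw [flagContactFiltration_def g₁ g₂ q r₁ r₂ (r₁ * ν)]
  refine iSup_le fun α => iSup_le fun β => ?_
  by_cases heq : r₁ * α + r₂ * β = r₁ * ν
  · refine le_sup_of_le_left (le_iSup_of_le α (le_iSup_of_le β (le_iSup_of_le heq ?_)))
    have he : (r₁ * ν - r₁ * α - r₂ * β + q - 1) / q = 0 := by
      rw [show r₁ * ν - r₁ * α - r₂ * β = 0 by omega, zero_add]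
      exact Nat.div_eq_of_lt (by omega)
    rw [he, pow_zero, mul_one]
  · refine le_sup_of_le_right ?_
    rw [Ideal.mul_le]
    intro i hi m hm
    obtain ⟨d, rfl⟩ := Ideal.mem_span_singleton'.mp hi
    have heq' : d * (g₁ ^ α * g₂ ^ β) * m = g₁ ^ α * g₂ ^ β * (d * m) := by ring
    rw [heq']
    refine mul_mem_flagContactFiltration_of_weight hQ (Ideal.mul_mem_left _ d hm) ?_
    have hk := le_mul_pieceExponent hq (r₁ * ν) r₁ r₂ α β
    have hcase : r₁ * α + r₂ * β < r₁ * ν ∨ (r₁ * ν - r₁ * α - r₂ * β + q - 1) / q = 0 := by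
      rcases lt_or_ge (r₁ * α + r₂ * β) (r₁ * ν) with h | h
      · exact Or.inl h
      · right
        rw [show r₁ * ν - r₁ * α - r₂ * β = 0 by omega, zero_add]
        exact Nat.div_eq_of_lt (by omega)
    have := purity_weight hj hqj hk hcase heq
    linarith

end Iota3

end Summit.ResolutionOfSingularities.ResolutionOfSingularities.Cruxes.HypersurfaceCentreConstruction.LocalEngine

end
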